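import Summits.AtomisticToContinuum.HydrodynamicLimit.Theorems.BoxDissipativeWeakStrongRelativeEnergyStabilityCoerciveHelpers
import Summits.AtomisticToContinuum.HydrodynamicLimit.Theorems.BoxDissipativeWeakStrongRelativeEnergyStabilityTimeZeroHelpers
import HarnessLib

/-!
# Crux `RelativeEnergyStability` (stmt-AtomisticToContinuum-17653), line `registered`:
helpers of the stub `stub_clampedRelEnergyCoercive` (S3') — the pointwise coercivity estimate

The deterministic half of S3': under `HsEosLowDensity` (band threshold `ηd` so small that the cut
compressibility is pinched in `(1/2, 3/2)` and `(ηZ)' ≥ 1/2` on the band, whence `R_cut ≥ ½ R_ideal`), for a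
classical hard-sphere Euler solution `(ρ,u,θ)` on `[0,T)`, `t ∈ [0,T)` and clamps `a < b` admissible on
`[0,t]` (deep lower clamp), Březina–Feireisl's clamped relative energy `ℰ_Z(U | (ρ,u,θ)(t,x))`
(`RES.clampedRelEnergy`, BrezinaFeireisl2018 (3.3)–(3.4)) is non-negative and controls the deviation of an
ADMISSIBLE box state `U = (ρ̂, m̂, Ê)` (`ρ̂ ≥ 0`; vacuum carries nothing; `Ê ≥ |m̂|²/(2ρ̂)`; frozen states
`Ê = |m̂|²/(2ρ̂)`, `ρ̂ > 0` only below a density threshold `ρs`) from the strong conserved state: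
for every `ε > 0`, `dev ≤ ε + K'(ε) · ℰ_Z` uniformly in `x ∈ 𝕋³` and `U` (`co_pointwise_estimate`, registered
helper sub-goal). It is assembled from the case lemmas of the `…CoerciveHelpers` file on the compact strong
range `K = (ρ,θ)(t, 𝕋³)` (`co_coercive_on_compact`: `dev ≤ C(ℰ_Z + √ℰ_Z)`), and `C√ℰ ≤ ε + C²ℰ/(4ε)`.

References: BrezinaFeireisl2018 §3.1–3.2 (3.8); FeireislNovotny2012 §3; Dafermos1979.
-/

noncomputable section

namespace Summit.AtomisticToContinuum.HydrodynamicLimit.Theorems.RES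

open MeasureTheory Filter Set
open scoped ENNReal Topology
open Summit.AtomisticToContinuum.HydrodynamicLimit.Theses.BoxDissipativeWeakStrong
open Literature.MathematicalPhysics.KineticTheory Literature.Analysis.FluidPDE
open Literature.Analysis.FluidPDE.CompressibleEuler
open Literature.Analysis.FluidPDE.CompressibleEuler.EulerPhase
open Literature.Analysis.FluidPDE.CompressibleEuler.StrongPointData

/-! ## Arithmetic of the final constants -/

/-- Vacuum bookkeeping: `dev ≤ D`, `p_min ≤ X` give `dev ≤ (D/p_min) X`. -/
theorem co_fin_vacuum {dev D pmin X : ℝ} (hD : dev ≤ D) (hD0 : 0 ≤ D) (hpmin : 0 < pmin) (hX : pmin ≤ X) :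
    dev ≤ D / pmin * X := by
  have h1 : D = D / pmin * pmin := by field_simp
  have h2 : D / pmin * pmin ≤ D / pmin * X := mul_le_mul_of_nonneg_left hX (div_nonneg hD0 hpmin.le)
  linarith

/-- Cold bookkeeping: `dev ≤ G₀(1 + ρ + Kin + E)`, `Kin + E + ρ + p_min ≤ X` give `dev ≤ G₀(1/p_min + 1) X`. -/
theorem co_fin_cold {dev G₀ pmin ρ Kin E X : ℝ} (hG₀ : 0 ≤ G₀) (hpmin : 0 < pmin) (hρ : 0 ≤ ρ)
    (hKin : 0 ≤ Kin) (hE : 0 ≤ E) (hX : Kin + E + ρ + pmin ≤ X) (hdev : dev ≤ G₀ * (1 + ρ + Kin + E)) :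
    dev ≤ G₀ * (1 / pmin + 1) * X := by
  have h1 : 1 ≤ X / pmin := by rw [le_div_iff₀ hpmin]; linarith
  have h2 : G₀ * (1 + ρ + Kin + E) ≤ G₀ * (X / pmin + X) := mul_le_mul_of_nonneg_left (by linarith) hG₀
  have h3 : G₀ * (X / pmin + X) = G₀ * (1 / pmin + 1) * X := by ring
  linarith

/-- Frozen bookkeeping: `dev ≤ G₀(1 + ρ + Kin + 0)`, `ρ ≤ ρs`, `Kin + p_min/2 ≤ X` give
`dev ≤ G₀(1 + ρs)(2/p_min + 1) X`. -/
theorem co_fin_frozen {dev G₀ pmin ρ ρs Kin X : ℝ} (hG₀ : 0 ≤ G₀) (hpmin : 0 < pmin) (hρ : 0 ≤ ρ)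
    (hρs : ρ ≤ ρs) (hKin : 0 ≤ Kin) (hX : Kin + pmin / 2 ≤ X) (hdev : dev ≤ G₀ * (1 + ρ + Kin + 0)) :
    dev ≤ G₀ * (1 + ρs) * (2 / pmin + 1) * X := by
  have hρs0 : 0 ≤ ρs := hρ.trans hρs
  have h1 : 1 ≤ 2 * X / pmin := by rw [le_div_iff₀ hpmin]; linarith
  have h2 : 1 + ρ + Kin + 0 ≤ (1 + ρs) * (1 + Kin) := by nlinarith
  have h3 : (1 + ρs) * (1 + Kin) ≤ (1 + ρs) * (2 * X / pmin + X) :=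
    mul_le_mul_of_nonneg_left (by linarith) (by linarith)
  have h4 := mul_le_mul_of_nonneg_left (h2.trans h3) hG₀
  have h5 : G₀ * ((1 + ρs) * (2 * X / pmin + X)) = G₀ * (1 + ρs) * (2 / pmin + 1) * X := by ring
  linarith

/-- Final combination: a linear bound with a smaller constant is a `C(X + √X)` bound. -/
theorem co_fin_combine {dev Cc C X : ℝ} (hCc : 0 ≤ Cc) (hC : Cc ≤ C) (hX : 0 ≤ X) (h : dev ≤ Cc * X) :
    dev ≤ C * (X + Real.sqrt X) := by
  have h1 : Cc * X ≤ C * X := mul_le_mul_of_nonneg_right hC hX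
  have h2 : 0 ≤ C * Real.sqrt X := mul_nonneg (hCc.trans hC) (Real.sqrt_nonneg X)
  linarith

/-- **From `C(X + √X)` to `ε + K'X`**: `C√X ≤ ε + C²X/(4ε)`. -/
theorem co_eps_of_sqrt {dev C ε X : ℝ} (hε : 0 < ε) (hX : 0 ≤ X) (h : dev ≤ C * (X + Real.sqrt X)) : dev ≤ ε + (C + C ^ 2 / (4 * ε)) * X := by
  have key : 4 * ε * (C * Real.sqrt X) ≤ 4 * ε * (ε + C ^ 2 / (4 * ε) * X) := by
    have e : 4 * ε * (ε + C ^ 2 / (4 * ε) * X) = 4 * ε ^ 2 + C ^ 2 * X := by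
      field_simp
    rw [e]
    nlinarith [sq_nonneg (2 * ε - C * Real.sqrt X), Real.sq_sqrt hX]
  have key' := le_of_mul_le_mul_left key (by positivity)
  nlinarith [key']

/-! ## Coercivity on a compact set of strong states -/

/-- **Coercivity of the clamped relative energy over a compact strong range.** For the cut law in the
smallness range (`R_cut ≥ ½R_ideal`, `Z_cut > 0`), a compact `K ⊂ (0,∞)²` of thermal reference states with the
deep clamp `μ_cut + Θa ≤ −1` on `K`, clamps `a ≤ b` and a velocity bound `WM`, there are `C ≥ 0` and a density
threshold `ρs > 0` such that for every reference `(r,Θ) ∈ K`, `‖W‖ ≤ WM` and every state `w` that is vacuum, in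
the open quadrant, or frozen (`E_int = 0`) with `0 < ρ ≤ ρs`: `0 ≤ ℰ_Z` and `dev(w) ≤ C (ℰ_Z + √ℰ_Z)`. -/
theorem co_coercive_on_compact {η₀ η₁ σ a b WM : ℝ} {F : ℝ → ℝ} (hF : AnalyticOnNhd ℝ F (Ioo (-η₀) η₀))
    (hEq : EqOn hsExcessFreeEnergy F (Ico 0 η₀)) (hη₁ : 0 < η₁) (hη₁₀ : η₁ < η₀) (hσ : 0 < σ)
    (hW' : ∀ η ∈ Ioo 0 η₁, (1 / 2 : ℝ) ≤ 1 + 2 * η * deriv F η + η ^ 2 * deriv (deriv F) η)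
    (hZ1 : (1 / 2 : ℝ) ≤ 1 + η₁ * deriv F η₁) (hZpos : ∀ η, 0 < η → 0 < cutCompressibility η₁ η)
    {K : Set (ℝ × ℝ)} (hK : IsCompact K) (hKq : K ⊆ Ioi 0 ×ˢ Ioi 0) (hab : a ≤ b) (hWM : 0 ≤ WM)
    (hdeep : ∀ q ∈ K, (cutEOS σ η₁).chemPotential q.1 q.2 + q.2 * a ≤ -1) :
    ∃ C ρs : ℝ, 0 ≤ C ∧ 0 < ρs ∧ ∀ (r Θ : ℝ) (W : V3), (r, Θ) ∈ K → ‖W‖ ≤ WM →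
      ∀ w : EulerPhase,
        (w = 0 ∨ (0 < dens w ∧ 0 < ien w) ∨ (0 < dens w ∧ ien w = 0 ∧ dens w ≤ ρs)) →
        0 ≤ (strongData r W Θ).relEnergyZ (cutEOS σ η₁) (clamp a b) w ∧
        |dens w - r| + ‖mom w - r • W‖ + |kineticEnergy w + ien w - totalEnergyDensity r W Θ| ≤
          C * ((strongData r W Θ).relEnergyZ (cutEOS σ η₁) (clamp a b) w +
            Real.sqrt ((strongData r W Θ).relEnergyZ (cutEOS σ η₁) (clamp a b) w)) := by
  obtain ⟨hG0, hS0, he0⟩ := cm_ideal_hypotheses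
  obtain ⟨δ₀, c₀, hδ₀, hc₀, -, hcoer⟩ := EulerEOS.relEnergyThermo_coercivity_near_far hG0 hS0 hK hKq
  obtain ⟨Cd, hCd, hCd'⟩ := EulerEOS.density_le_of_relEnergyThermo hG0 hS0 hK hKq
  obtain ⟨Ce, hCe, hCe'⟩ := EulerEOS.energy_entropy_le_of_relEnergyThermo hG0 hS0 he0 hK hKq
  -- bounds of the strong data over `K`
  obtain ⟨rM, hrM0, hrM⟩ := EulerEOS.exists_nonneg_forall_abs_le_of_continuousOn hK continuousOn_fst
  obtain ⟨ΘM, hΘM0, hΘM⟩ := EulerEOS.exists_nonneg_forall_abs_le_of_continuousOn hK continuousOn_snd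
  obtain ⟨μM, hμM0, hμM⟩ := EulerEOS.exists_nonneg_forall_abs_le_of_continuousOn hK
    ((cc_continuousOn_chemPotential hF hEq hη₁ hη₁₀ hσ).mono hKq)
  have hpC : ContinuousOn (fun q : ℝ × ℝ => (cutEOS σ η₁).p q.1 q.2) (Ioi 0 ×ˢ Ioi 0) := by
    have hZ : ContinuousOn (fun q : ℝ × ℝ => cutCompressibility η₁ (q.1 * σ ^ 3)) (Ioi 0 ×ˢ Ioi 0) :=
      (cc_continuousOn_cutCompressibility hF hEq hη₁ hη₁₀).comp (continuousOn_fst.mul continuousOn_const)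
        fun q hq => mul_pos hq.1 (pow_pos hσ 3)
    simp only [tz_p_eq]
    exact (continuousOn_fst.mul continuousOn_snd).mul hZ
  obtain ⟨pmin, hpmin, hpminle⟩ := hK.exists_forall_le' (hpC.mono hKq) (a := 0) fun q hq => by
    show 0 < q.1 * q.2 * cutCompressibility η₁ (q.1 * σ ^ 3)
    exact mul_pos (mul_pos (hKq hq).1 (hKq hq).2) (hZpos _ (mul_pos (hKq hq).1 (pow_pos hσ 3)))
  -- the constants (kept opaque)
  obtain ⟨Zb, hZb⟩ : ∃ Zb : ℝ, Zb = max |a| |b| := ⟨_, rfl⟩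
  have hZb0 : 0 ≤ Zb := by rw [hZb]; exact (abs_nonneg a).trans (le_max_left _ _)
  obtain ⟨G₀, hG₀⟩ : ∃ G₀ : ℝ, G₀ = 2 + 4 * WM + WM ^ 2 + rM * (1 + WM + WM ^ 2 + 2 * ΘM) := ⟨_, rfl⟩
  have hG₀0 : 0 ≤ G₀ := by rw [hG₀]; positivity
  obtain ⟨ρs, hρs⟩ : ∃ ρs : ℝ, ρs = pmin / (2 * (μM + ΘM * Zb + 1)) := ⟨_, rfl⟩
  have hρs0 : 0 < ρs := by rw [hρs]; positivity
  have hρs' : ρs * (μM + ΘM * max |a| |b|) ≤ pmin / 2 := by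
    rw [hρs, ← hZb, div_mul_eq_mul_div, div_le_iff₀ (by positivity : (0 : ℝ) < 2 * (μM + ΘM * Zb + 1))]
    have : 0 ≤ pmin * 1 := by linarith
    nlinarith [this]
  obtain ⟨CV, hCV⟩ : ∃ CV : ℝ, CV = rM * (1 + WM + WM ^ 2 / 2 + 3 / 2 * ΘM) / pmin := ⟨_, rfl⟩
  obtain ⟨Cc, hCc⟩ : ∃ Cc : ℝ, Cc = G₀ * (1 / pmin + 1) := ⟨_, rfl⟩
  obtain ⟨Cf, hCf⟩ : ∃ Cf : ℝ, Cf = G₀ * (1 + ρs) * (2 / pmin + 1) := ⟨_, rfl⟩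
  obtain ⟨Cr, hCr⟩ : ∃ Cr : ℝ, Cr = G₀ * (2 + 2 * ((1 + Ce) * (1 + Cd) + Ce) * (1 / c₀ + 1)) := ⟨_, rfl⟩
  obtain ⟨Cn, hCn⟩ : ∃ Cn : ℝ, Cn = ((1 + WM + WM ^ 2 / 2 + 3 / 2 * ΘM) + 3 / 2 * (rM + δ₀)) *
      Real.sqrt (2 / c₀) + (1 + 3 * WM) * Real.sqrt (2 * (rM + δ₀)) + 1 := ⟨_, rfl⟩
  have hCV0 : 0 ≤ CV := by rw [hCV]; positivity
  have hCc0 : 0 ≤ Cc := by rw [hCc]; positivity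
  have hCf0 : 0 ≤ Cf := by rw [hCf]; positivity
  have hCr0 : 0 ≤ Cr := by rw [hCr]; positivity
  have hCn0 : 0 ≤ Cn := by rw [hCn]; positivity
  refine ⟨CV + Cc + Cf + Cr + Cn, ρs, by positivity, hρs0, fun r Θ W hmem hW w hw => ?_⟩
  have hleV : CV ≤ CV + Cc + Cf + Cr + Cn := by linarith only [hCc0, hCf0, hCr0, hCn0]
  have hlec : Cc ≤ CV + Cc + Cf + Cr + Cn := by linarith only [hCV0, hCf0, hCr0, hCn0]
  have hlef : Cf ≤ CV + Cc + Cf + Cr + Cn := by linarith only [hCV0, hCc0, hCr0, hCn0]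
  have hler : Cr ≤ CV + Cc + Cf + Cr + Cn := by linarith only [hCV0, hCc0, hCf0, hCn0]
  have hlen : Cn ≤ CV + Cc + Cf + Cr + Cn := by linarith only [hCV0, hCc0, hCf0, hCr0]
  have hr : 0 < r := (hKq hmem).1
  have hΘ : 0 < Θ := (hKq hmem).2
  have hrle : r ≤ rM := (le_abs_self r).trans (hrM _ hmem)
  have hΘle : Θ ≤ ΘM := (le_abs_self Θ).trans (hΘM _ hmem)
  have hp : pmin ≤ (cutEOS σ η₁).p r Θ := hpminle _ hmem
  have hμ : |(cutEOS σ η₁).chemPotential r Θ| ≤ μM := hμM _ hmem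
  have hW0 : 0 ≤ ‖W‖ := norm_nonneg W
  rcases hw with rfl | ⟨hρ, hE⟩ | ⟨hρ, hE, hρle⟩
  · -- the vacuum
    obtain ⟨hZ, hdev⟩ := co_vacuum σ η₁ a b r Θ W
    rw [hZ, hdev]
    have hX0 : 0 ≤ (cutEOS σ η₁).p r Θ := hpmin.le.trans hp
    have hEt0 : 0 ≤ totalEnergyDensity r W Θ := by unfold totalEnergyDensity; positivity
    have hD : |r| + |r| * ‖W‖ + |totalEnergyDensity r W Θ| ≤ rM * (1 + WM + WM ^ 2 / 2 + 3 / 2 * ΘM) := by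
      rw [abs_of_pos hr, abs_of_nonneg hEt0]
      unfold totalEnergyDensity
      have hW2 : ‖W‖ ^ 2 ≤ WM ^ 2 := pow_le_pow_left₀ hW0 hW 2
      have e1 : r * ‖W‖ ≤ rM * WM := mul_le_mul hrle hW hW0 hrM0
      have e2 : r * (‖W‖ ^ 2 / 2 + 3 / 2 * Θ) ≤ rM * (WM ^ 2 / 2 + 3 / 2 * ΘM) :=
        mul_le_mul hrle (by linarith only [hW2, hΘle]) (by positivity) hrM0
      linarith only [e1, e2, hrle]
    have hcase : |r| + |r| * ‖W‖ + |totalEnergyDensity r W Θ| ≤ CV * (cutEOS σ η₁).p r Θ := by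
      rw [hCV]; exact co_fin_vacuum hD (by positivity) hpmin hp
    exact ⟨hX0, co_fin_combine hCV0 hleV hX0 hcase⟩
  · -- the open quadrant
    have hKin0 := co_kin_nonneg W hρ.le
    have hdevG := co_dev_general (w := w) hρ hE.le hr.le hrle hΘ.le hΘle hW
    rw [← hG₀] at hdevG
    by_cases hcold : (cutEOS σ η₁).s (dens w) (stateTemp (cutEOS σ η₁) (dens w) (ien w)) < a
    · -- cold: the deep clamp
      have hX := co_cold_lower W hρ hab hcold (hdeep _ hmem) hp
      have hX0 : 0 ≤ (strongData r W Θ).relEnergyZ (cutEOS σ η₁) (clamp a b) w := by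
        linarith only [hX, hKin0, hρ.le, hE.le, hpmin.le]
      have hcase := co_fin_cold hG₀0 hpmin hρ.le hKin0 hE.le hX hdevG
      rw [← hCc] at hcase
      exact ⟨hX0, co_fin_combine hCc0 hlec hX0 hcase⟩
    · -- hot
      have hsa : a ≤ (cutEOS σ η₁).s (dens w) (stateTemp (cutEOS σ η₁) (dens w) (ien w)) := not_lt.1 hcold
      obtain ⟨hR0, hX⟩ := co_hot_lower hF hEq hη₁ hη₁₀ hσ hW' hZ1 W hr hΘ hρ hE hsa
      have hϑ : 0 < 2 * ien w / (3 * dens w) := div_pos (by linarith only [hE]) (by linarith only [hρ])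
      have hX0 : 0 ≤ (strongData r W Θ).relEnergyZ (cutEOS σ η₁) (clamp a b) w :=
        (add_nonneg hKin0 (div_nonneg hR0 zero_le_two)).trans hX
      refine ⟨hX0, ?_⟩
      have hcf := hcoer r Θ (dens w) (2 * ien w / (3 * dens w)) hmem hρ hϑ
      by_cases hnear : |dens w - r| ≤ δ₀ ∧ |2 * ien w / (3 * dens w) - Θ| ≤ δ₀
      · -- essential region
        have hq := hcf.1 hnear.1 hnear.2
        have hdevN := co_dev_near r W (w := w) hρ hΘ.le
        have hρM : dens w ≤ rM + δ₀ := by linarith only [(abs_le.1 hnear.1).2, hrle]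
        have hny : ‖mom w - dens w • W‖ ^ 2 =
            2 * dens w * (dens w / 2 * ∑ i : Fin 3, (mom w i / dens w - W i) ^ 2) := by
          rw [co_norm_sub_sq W hρ.ne']; ring
        have hA : |dens w - r| * (1 + ‖W‖ + ‖W‖ ^ 2 / 2 + 3 / 2 * Θ) ≤
            |dens w - r| * (1 + WM + WM ^ 2 / 2 + 3 / 2 * ΘM) := by
          refine mul_le_mul_of_nonneg_left ?_ (abs_nonneg _)
          linarith only [pow_le_pow_left₀ hW0 hW 2, hW, hΘle]
        have hB : ‖mom w - dens w • W‖ * (1 + 3 * ‖W‖) ≤ ‖mom w - dens w • W‖ * (1 + 3 * WM) :=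
          mul_le_mul_of_nonneg_left (by linarith only [hW]) (norm_nonneg _)
        have h := co_case_near (dev := |dens w - r| + ‖mom w - r • W‖ +
            |kineticEnergy w + ien w - totalEnergyDensity r W Θ|)
          (by positivity : (0 : ℝ) ≤ 1 + WM + WM ^ 2 / 2 + 3 / 2 * ΘM) (by positivity : (0 : ℝ) ≤ 1 + 3 * WM)
          (norm_nonneg _) hρ.le hρM hKin0 hc₀ hq hX hny (by linarith only [hdevN, hA, hB])
        rw [← hCn] at h
        exact h.trans (mul_le_mul_of_nonneg_right hlen (add_nonneg hX0 (Real.sqrt_nonneg _)))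
      · -- residual region
        have hfar : δ₀ ≤ |dens w - r| ∨ δ₀ ≤ |2 * ien w / (3 * dens w) - Θ| := by
          rcases not_and_or.1 hnear with h | h
          · exact Or.inl (not_le.1 h).le
          · exact Or.inr (not_le.1 h).le
        have hRc := hcf.2 hfar
        have hρC := hCd' r Θ (dens w) _ hmem hρ hϑ
        have hEC := (hCe' r Θ (dens w) _ hmem hρ hϑ).1
        have hEe : dens w * (EulerEOS.monatomicExcess (fun _ => 1) (fun _ => 0)).e (dens w)
            (2 * ien w / (3 * dens w)) = ien w := by
          show dens w * (3 / 2 * (2 * ien w / (3 * dens w))) = ien w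
          field_simp
        rw [hEe] at hEC
        have hcase := co_case_far hG₀0 hKin0 hc₀ hCd.le hCe.le hRc hρC hEC hX hdevG
        rw [← hCr] at hcase
        exact co_fin_combine hCr0 hler hX0 hcase
  · -- frozen states of small density
    have hKin0 := co_kin_nonneg W hρ.le
    have hdevG := co_dev_general (w := w) hρ hE.symm.le hr.le hrle hΘ.le hΘle hW
    rw [← hG₀] at hdevG
    have hX := co_frozen_lower W hρ hE hab hμ hΘ.le hΘle hp hρle hρs'
    have hX0 : 0 ≤ (strongData r W Θ).relEnergyZ (cutEOS σ η₁) (clamp a b) w := by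
      linarith only [hX, hKin0, hpmin.le]
    refine ⟨hX0, ?_⟩
    rw [hE] at hdevG ⊢
    have hcase := co_fin_frozen hG₀0 hpmin hρ.le hρle hKin0 hX hdevG
    rw [← hCf] at hcase
    exact co_fin_combine hCf0 hlef hX0 hcase

/-! ## The pointwise estimate along a strong solution -/

/-- **The pointwise coercivity estimate of S3'** (registered helper sub-goal). Given the data of
`HsEosLowDensity` (`f_ex = F` analytic on `[0, η₀)`) there is `0 < ηd ≤ η₀` such that for every band `0 < η₁ < ηd`, `σ > 0`, classical hard-sphere Euler solution on
`[0,T)`, `t ∈ [0,T)` and clamps admissible on `[0,t]`, there is a density threshold `ρs > 0` with: for every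
`ε > 0` some `K' ≥ 0` makes `dev(U | (ρ,ρu,E)(t,x)) ≤ ε + K' ℰ_Z(U | (ρ,u,θ)(t,x))` and `0 ≤ ℰ_Z` for ALL
`x ∈ 𝕋³` and ALL admissible box states `U = (ρ̂, m̂, Ê)` (`ρ̂ ≥ 0`; `ρ̂ = 0 ⇒ m̂ = 0, Ê = 0`;
`Ê ≥ |m̂|²/(2ρ̂)`; and `ρ̂ ≤ ρs` whenever `Ê = |m̂|²/(2ρ̂)` with `ρ̂ > 0`). -/
theorem co_pointwise_estimate {η₀ : ℝ} {F : ℝ → ℝ} (hη₀ : 0 < η₀) (hF : AnalyticOnNhd ℝ F (Ioo (-η₀) η₀)) (hEq : EqOn hsExcessFreeEnergy F (Ico 0 η₀)) : ∃ ηd : ℝ, 0 < ηd ∧ ηd ≤ η₀ ∧ ∀ η₁ : ℝ, 0 < η₁ → η₁ < ηd → ∀ σ : ℝ, 0 < σ → ∀ (T : ℝ) (ρ θ : ℝ → T3 → ℝ) (u : ℝ → T3 → V3), IsHardSphereEulerSolution σ T ρ u θ → ∀ t ∈ Ico 0 T, ∀ a b : ℝ, ClampAdmissible σ η₁ a b ρ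 θ t → ∃ ρs : ℝ, 0 < ρs ∧ ∀ ε : ℝ, 0 < ε → ∃ K' : ℝ, 0 ≤ K' ∧ ∀ (x : T3) (U : BoxState), 0 ≤ U.1 → (U.1 = 0 → U.2.1 = 0 ∧ U.2.2 = 0) → 0 ≤ U.2.2 - ‖U.2.1‖ ^ 2 / (2 * U.1) → (0 < U.1 → U.2.2 - ‖U.2.1‖ ^ 2 / (2 * U.1) = 0 → U.1 ≤ ρs) → 0 ≤ clampedRelEnergy σ η₁ a b (ρ t x) (u t x) (θ t x) U ∧ |U.1 - ρ t x| + ‖U.2.1 - ρ t x • u t x‖ + |U.2.2 - totalEnergyDensity (ρ t x) (u t x) (θ t x)| ≤ ε + K' * clampedRelEnergy σ η₁ a b (ρ t x) (u t x) (θ t x) U := by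
  -- smallness scales of `(ηZ)' = 1 + 2ηF' + η²F''` and `Z = 1 + ηF'` at `η = 0`
  have h0U : (0 : ℝ) ∈ Ioo (-η₀) η₀ := ⟨by linarith, hη₀⟩
  have hF1c : ContinuousAt (deriv F) 0 := hF.deriv.continuousOn.continuousAt (isOpen_Ioo.mem_nhds h0U)
  have hF2c : ContinuousAt (deriv (deriv F)) 0 :=
    hF.deriv.deriv.continuousOn.continuousAt (isOpen_Ioo.mem_nhds h0U)
  obtain ⟨ε₁, hε₁, hWε⟩ := cm_near_one (g := fun η => 1 + 2 * η * deriv F η + η ^ 2 * deriv (deriv F) η)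
    (by fun_prop) (by simp)
  obtain ⟨ε₂, hε₂, hZf⟩ := cm_near_one (g := fun η => 1 + η * deriv F η) (by fun_prop) (by simp)
  refine ⟨min (min ε₁ ε₂) (η₀ / 2), lt_min (lt_min hε₁ hε₂) (by linarith),
    (min_le_right _ _).trans (by linarith), ?_⟩
  intro η₁ hη₁ hη₁d σ hσ T ρ θ u hsol t ht a b hadm
  have hη₁ε₁ : η₁ < ε₁ := hη₁d.trans_le ((min_le_left _ _).trans (min_le_left _ _))
  have hη₁ε₂ : η₁ < ε₂ := hη₁d.trans_le ((min_le_left _ _).trans (min_le_right _ _))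
  have hη₁₀ : η₁ < η₀ := by linarith [hη₁d.trans_le (min_le_right (min ε₁ ε₂) (η₀ / 2))]
  have hW' : ∀ η ∈ Ioo 0 η₁, (1 / 2 : ℝ) ≤ 1 + 2 * η * deriv F η + η ^ 2 * deriv (deriv F) η :=
    fun η hη => (hWε η (by rw [abs_of_pos hη.1]; linarith [hη.2])).1.le
  have hZ1 : (1 / 2 : ℝ) ≤ 1 + η₁ * deriv F η₁ := (hZf η₁ (by rw [abs_of_pos hη₁]; linarith)).1.le
  have hZpos : ∀ η, 0 < η → 0 < cutCompressibility η₁ η := by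
    intro η hη
    have hm0 : 0 < min η η₁ := lt_min hη hη₁
    have h := hZf (min η η₁) (by rw [abs_of_pos hm0]; linarith [min_le_right η η₁])
    rw [cutCompressibility, hsCompressibility_eq hEq ⟨hm0, (min_le_right _ _).trans_lt hη₁₀⟩]
    linarith [h.1]
  -- the strong data at time `t`
  have hρc : Continuous (ρ t) := (hsol.smooth_density.isSmooth_slice ht).continuous
  have huc : Continuous (u t) := (hsol.smooth_velocity.isSmooth_slice ht).continuous
  have hθc : Continuous (θ t) := (hsol.smooth_temperature.isSmooth_slice ht).continuous
  have hρ0 : ∀ x, 0 < ρ t x := hsol.density_pos t ht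
  have hθ0 : ∀ x, 0 < θ t x := hsol.temperature_pos t ht
  have hK : IsCompact (range fun x => (ρ t x, θ t x)) := isCompact_range (hρc.prodMk hθc)
  have hKq : (range fun x => (ρ t x, θ t x)) ⊆ Ioi 0 ×ˢ Ioi 0 := by
    rintro _ ⟨x, rfl⟩; exact ⟨hρ0 x, hθ0 x⟩
  obtain ⟨WM, hWM⟩ : ∃ WM : ℝ, ∀ x, ‖u t x‖ ≤ WM := by
    obtain ⟨B, hB⟩ := isCompact_univ.exists_bound_of_continuousOn huc.continuousOn
    exact ⟨B, fun x => hB x (mem_univ x)⟩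
  have hWM0 : 0 ≤ WM := (norm_nonneg _).trans (hWM 0)
  obtain ⟨hab, -, hdeepT⟩ := hadm
  have hdeep : ∀ q ∈ range (fun x => (ρ t x, θ t x)),
      (cutEOS σ η₁).chemPotential q.1 q.2 + q.2 * a ≤ -1 := by
    rintro _ ⟨x, rfl⟩; exact hdeepT t ⟨ht.1, le_rfl⟩ x
  obtain ⟨C, ρs, hC0, hρs, hmain⟩ :=
    co_coercive_on_compact hF hEq hη₁ hη₁₀ hσ hW' hZ1 hZpos hK hKq hab.le hWM0 hdeep
  refine ⟨ρs, hρs, fun ε hε => ⟨C + C ^ 2 / (4 * ε), by positivity, fun x U hU1 hU0 hUi hUf => ?_⟩⟩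
  have hmem : (ρ t x, θ t x) ∈ range (fun x => (ρ t x, θ t x)) := mem_range_self x
  -- the trichotomy for the phase-space reading of `U`
  have hw : boxPhase U = 0 ∨ (0 < dens (boxPhase U) ∧ 0 < ien (boxPhase U)) ∨
      (0 < dens (boxPhase U) ∧ ien (boxPhase U) = 0 ∧ dens (boxPhase U) ≤ ρs) := by
    rcases hU1.eq_or_lt with h0 | hpos
    · left
      obtain ⟨hm, hE⟩ := hU0 h0.symm
      rw [show boxPhase U = (U.1, U.2.2 - ‖U.2.1‖ ^ 2 / (2 * U.1), U.2.1) from rfl, ← h0, hm, hE]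
      simp
    · rcases hUi.eq_or_lt with h0 | hpos'
      · exact Or.inr (Or.inr ⟨hpos, h0.symm, hUf hpos h0.symm⟩)
      · exact Or.inr (Or.inl ⟨hpos, hpos'⟩)
  obtain ⟨hpos, hdev⟩ := hmain (ρ t x) (θ t x) (u t x) hmem (hWM x) (boxPhase U) hw
  have hd3 : kineticEnergy (boxPhase U) + ien (boxPhase U) = U.2.2 := by
    simp only [kineticEnergy, boxPhase, dens_mk, ien_mk, mom_mk]; ring
  rw [hd3] at hdev
  exact ⟨hpos, co_eps_of_sqrt hε hpos hdev⟩

end Summit.AtomisticToContinuum.HydrodynamicLimit.Theorems.RES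

end
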